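import Summits.HodgeConjecture.HodgeConjecture.Theorems.Ring2HypothesesCMPowerAnchors
import HarnessLib

/-!
# Ring-2 hypotheses layer, part IX — CM-POWER-pointed Weil families in the TRANSPORT layer (imaginary quadratic `K`,
all discriminants at once): Weil's question R∞ and its ledger corollaries from the CM-germ leaf, WITHOUT `HC_CM`

HONEST FRAMING (page 1): research route conditional on HC_CM; not a corollary; Q11.4-sentence-2 already refuted in
dim ≥ 3. `HC_CM` is `Theses.RankFourFaces.CMAbelianHodge` (stmt-HodgeConjecture-3052), bound BY NAME wherever it
occurs in the hypotheses layer. The point of this file — as of part VIII — is a set of rows where it does NOT occur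
because it is a THEOREM at the anchor fibre (Tate: `Hdg = Div` on an abelian variety isogenous to a power of a CM
elliptic curve; Literature `EllipticCurve.hodgeConjectureFor_of_isIsogenous_powSucc_of_cm`, consumed through part
VIII's `cmPowerAnchor_valid`). NOTHING here proves a case of the Hodge conjecture the tree did not have.

WHAT THIS FILE ADDS. Part VIII typed the CM-power anchor for the δ-indexed component targets of part VII. The
TRANSPORT layer's non-δ targets (`Ring2Transport.CMPointedWeilFamiliesQuadratic` → R∞ =
`WeilTypeLadder.WeilClassesImaginaryQuadratic`, the CM-germ leaf `Ring2Transport.LocalWeilVHCAtCMQuadratic`, and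
the ledger corollaries stmt-2522 / stmt-2524 / rung R2) so far come in two flavours: WITH the binder `hCM`
(`Ring2Transport.HC_WeilClassesQuadratic_of_HC_CM[_local]`) or with a DIVISOR-GENERATED CM chart
(`Ring2Transport.HC_WeilClassesQuadratic_of_divisorGeneratedCMPointed[_local]`, `Hdg = Div` asked ON THE CHART).
Here: the third flavour, the chart ISOGENOUS TO A POWER OF ONE CM ELLIPTIC CURVE — the members `E_Kⁿ × E_Kⁿ` /
`E_i^{2n}` of van Geemen's families (an INFERENCE of this layer from his construction 5.5–5.8 / 5.12 — a `K`-rational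
positive `V₊`, resp. `τ = i·I ∈ H_A` — not a sentence of [vG]; see part VIII's module docstring) — for which `HC_CM`
is DISCHARGED by Tate's theorem and no divisor-generation clause is asked.

| row | Lean name | hypotheses (all typed, none an axiom) | what it says |
|---|---|---|---|
| leaf | `CMPowerPointedWeilFamiliesQuadratic` | — (`@[conjecture]`, OPEN as a formal statement; met in print on components with an `E_K`-power member) | `CMPointedWeilFamiliesQuadratic` with the CM point a CM-POWER point (`cmPowerAnchor`) |
| T0 | `cmPointedWeilFamiliesQuadratic_of_cmPowerPointed`, `anchoredWeilFamiliesQuadratic_of_cmPowerPointed` | leaf | CM-power-pointed ⟹ CM-pointed; CM-power-pointed ⟹ ANCHORED (R∞anc) — NO `HC_CM` |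
| T1 | `HC_WeilClassesQuadratic_of_cmPowerPointed` | leaf + `WeilVariationalHodgeQuadratic` | R∞ — NO `HC_CM` (compare `HC_WeilClassesQuadratic_of_HC_CM`) |
| T2 | `HC_WeilClassesQuadratic_of_cmPowerPointed_local` | leaf + `LocalWeilVHCAtCMQuadratic` (the CM-GERM leaf, the tree's weakest transport hypothesis) | R∞ — NO `HC_CM` (compare `HC_WeilClassesQuadratic_of_HC_CM_local`) |
| T3 | `weilClassesImaginaryQuadratic_iff_localWeilVHCAtCM_of_cmPowerPointed` | leaf | R∞ ⟺ CM-germ leaf — NO `HC_CM` (compare `Ring2Transport.weilClassesImaginaryQuadratic_iff_localWeilVHCAtCM_of_HC_CM`) |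
| T4 | `HC_WeilClassesAlgebraic_of_cmPowerPointed`, `HC_WeilSixfolds_of_cmPowerPointed`, `HC_SplitWeil_of_cmPowerPointed` | leaf + CM-germ leaf | stmt-HodgeConjecture-2522, stmt-HodgeConjecture-2524, rung R2 — NO `HC_CM` |
| T5 | `weilClassesImaginaryQuadratic_of_forall_cmPowerPointedComponent` | ∀δ part VIII's `CMPowerPointedWeilFamiliesComponent` + ∀δ `WeilVariationalHodgeComponent` + typed vG Lemma 5.2 | R∞ from the δ-indexed CM-power rows (W1‴ assembled over δ by VII-B's W3) — NO `HC_CM` |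

HONEST COLUMN. (1) The leaf is NOT a case of HC (a CM-power fibre is data HC does not give) — no on-path lemma, as for
every CM-pointed leaf of the layer. (2) In print the leaf is met exactly where `DivisorGeneratedCMPointedWeilFamilies
Quadratic` is (the same members `E_K^{2n}`); in the kernel the two are INCOMPARABLE (isogeny to `Eᴺ⁺¹` vs `Hdg = Div`
on the chart; no isogeny transport of `divisorClassesSpan` in the tree). (3) What stays OPEN is the transport
statement: `WeilVariationalHodgeQuadratic` / the CM-germ leaf (OPEN for `n ≥ 3` except the sixfold cells of print),
exactly as in gen 1–5. (4) Print scope of Tate's theorem (vG Thm. 4.3: "isogeneous to a product of elliptic curves")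
is wider than the kernel's (powers of ONE CM elliptic curve). [cite: vanGeemen1994HodgeAV, Thm. 4.3, 4.10, 5.12]
[cite: Deligne1982HodgeCycles, §4, proof of Thm. 4.8 (a)–(c) and §5] [cite: Mumford1969NoteShimura, §3]
[cite: CharlesSchnell2014Notes, Prop. 11.3.11] [cite: BuchweitzFlenner2003, Thm. 5.1]
-/

set_option linter.dupNamespace false

open CategoryTheory
open Literature.AlgebraicGeometry Literature.AlgebraicGeometry.Motives
open Literature.AlgebraicGeometry.HodgeTheory
open Literature.AlgebraicTopology.SingularHomology
open Literature.AlgebraicGeometry.Milne1999 (IsOfCMType)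
open Literature.AlgebraicGeometry.VanGeemen1994
open Summit.HodgeConjecture.HodgeConjecture.WeilTypeLadder
open Summit.HodgeConjecture.HodgeConjecture.Theses
open Summit.HodgeConjecture.HodgeConjecture.Ring2Transport

namespace Summit.HodgeConjecture.HodgeConjecture.Ring2.Hypotheses

/-! ## §1 The CM-power-pointed quadratic Weil families leaf -/

/-- **CM-POWER-pointed Weil families, imaginary quadratic `K = ℚ(√-d)`, every discriminant (typed missing input;
Summit-side leaf, NOT a Literature fact, NOT a case of HC — hence no on-path lemma).** VERBATIM
`Ring2Transport.CMPointedWeilFamiliesQuadratic` with its last conjunct "the fibre `𝒳_{s₀}` is presented by a CM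
abelian variety `A₀` of dimension `2n`" REPLACED by part VIII's `cmPowerAnchor n`: `A₀` is ISOGENOUS TO A POWER
`Eᴺ⁺¹` OF A CM ELLIPTIC CURVE (`dim E = 1`, `ψ ≫ ψ = -(d'•𝟙)`, `0 < d'`). In print: every polarized abelian variety
of Weil type is a member of an `n²`-dimensional family of such (vG 4.10), the flat Weil section is a global class
(Deligne's global invariant cycle theorem), and the components exhibited in print contain an `E_K`-power member
(`E_i^{2n}` at `τ = i·I ∈ H_A` on vG's `(ℚ(i), 2n, det H = 1)` family 5.12; a `K`-rational positive `V₊` in 5.5–5.8 in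
general — this layer's INFERENCE from the construction, not a printed sentence). OPEN as a formal statement of the tree
(no moduli space of Weil type in `Literature/`); NOT claimed for any `(d, det H)` by this file.
[cite: vanGeemen1994HodgeAV, 4.10, 5.5–5.8 and 5.12]
[cite: Deligne1982HodgeCycles, §4, proof of Thm. 4.8 (a)–(c) and §5] [cite: Mumford1969NoteShimura, §3] [status: open] -/
@[conjecture] def CMPowerPointedWeilFamiliesQuadratic : Prop :=
  ∀ (n : ℕ), 2 ≤ n → ∀ (d : ℕ), 0 < d → ∀ (A : Motives.AbelianVariety ℂ) (φ : A ⟶ A), A.dim = 2 * n →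
    Motives.IsSmoothProjective (2 * n) A.X → φ ≫ φ = -(d • 𝟙 A) →
      ∀ c : complexBetti A.X (2 * n), IsRationalClass c → IsOfHodgeType (2 * n) A.X (2 * n) n n c →
        c ∈ weilClassesOf A φ n d → c ≠ 0 →
        ∃ (𝒳 S : Motives.SchemeOver ℂ) (f : 𝒳 ⟶ S) (s₁ s₀ : Motives.ComplexPoints S)
            (ι : A.X ≅ Motives.fiberOver f s₁) (W : complexBetti 𝒳 (2 * n)),
          Motives.IsSmoothProjectiveFamily f (2 * n) ∧ IsQuasiProjectiveOver 𝒳 ∧ IsQuasiProjectiveOver S ∧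
          IrreducibleSpace S.left ∧ AlgebraicGeometry.Smooth S.hom ∧
          (∀ s : Motives.ComplexPoints S,
            IsRationalClass (complexBetti.map (Motives.fiberι f s) (2 * n) W) ∧
              IsOfHodgeType (2 * n) (Motives.fiberOver f s) (2 * n) n n
                (complexBetti.map (Motives.fiberι f s) (2 * n) W)) ∧
          (∀ s : Motives.ComplexPoints S, ∃ (A' : Motives.AbelianVariety ℂ) (φ' : A' ⟶ A')
              (e' : A'.X ≅ Motives.fiberOver f s),
            A'.dim = 2 * n ∧ φ' ≫ φ' = -(d • 𝟙 A') ∧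
              complexBetti.map e'.hom (2 * n) (complexBetti.map (Motives.fiberι f s) (2 * n) W) ∈
                weilClassesOf A' φ' n d) ∧
          complexBetti.map ι.hom (2 * n) (complexBetti.map (Motives.fiberι f s₁) (2 * n) W) = c ∧
          cmPowerAnchor n (Motives.fiberOver f s₀) (complexBetti.map (Motives.fiberι f s₀) (2 * n) W)

/-! ## §2 Bookkeeping: CM-power-pointed ⟹ CM-pointed, and ⟹ ANCHORED without `HC_CM` -/

/-- T0: a CM-power-pointed family is CM-pointed (`cmAnchor_of_cmPowerAnchor`: a power of a CM elliptic curve, and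
anything isogenous to it, is of CM type — part VIII `EllipticCurve.isOfCMType_of_cm`). [cite: Milne1999, §2 (p. 54)] -/
theorem cmPointedWeilFamiliesQuadratic_of_cmPowerPointed (hP : CMPowerPointedWeilFamiliesQuadratic) :
    CMPointedWeilFamiliesQuadratic := by
  intro n hn d hd A φ hAdim hX hφ c hcQ hcH hc hc0
  obtain ⟨𝒳, S, f, s₁, s₀, ι, W, hf, h𝒳, hS, hirrS, hsm, hW, hWeil, hread, hanc⟩ :=
    hP n hn d hd A φ hAdim hX hφ c hcQ hcH hc hc0
  exact ⟨𝒳, S, f, s₁, s₀, ι, W, hf, h𝒳, hS, hirrS, hsm, hW, hWeil, hread, cmAnchor_of_cmPowerAnchor hanc⟩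

/-- **T0: a CM-power-pointed Weil family is an ANCHORED Weil family — NO `HC_CM`** (R∞anc,
`WeilTypeLadder.AnchoredWeilFamiliesQuadratic`): the restricted class at the CM-power fibre is algebraic by part
VIII's `cmPowerAnchor_valid` (Tate along the chart). Compare `Ring2Transport.anchoredWeilFamiliesQuadratic_of_HC_CM_of_cmPointed`
(binder `hCM`) and `…_of_divisorGeneratedCMPointed` (`Hdg = Div` on the chart). [cite: vanGeemen1994HodgeAV, Thm. 4.3] -/
theorem anchoredWeilFamiliesQuadratic_of_cmPowerPointed (hP : CMPowerPointedWeilFamiliesQuadratic) :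
    AnchoredWeilFamiliesQuadratic := by
  intro n hn d hd A φ hAdim hX hφ c hcQ hcH hc hc0
  obtain ⟨𝒳, S, f, s₁, s₀, ι, W, hf, h𝒳, hS, hirrS, hsm, hW, hWeil, hread, hanc⟩ :=
    hP n hn d hd A φ hAdim hX hφ c hcQ hcH hc hc0
  exact ⟨𝒳, S, f, s₁, s₀, ι, W, hf, h𝒳, hS, hirrS, hsm, hW, hWeil, hread,
    cmPowerAnchor_valid n _ _ hanc (hW s₀).1 (hW s₀).2⟩

/-! ## §3 R∞ without `HC_CM` -/

/-- **T1 — R∞ (Weil's question, every imaginary quadratic `K`, every `n ≥ 2`, every `d`) WITHOUT `HC_CM`**: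
`CMPowerPointedWeilFamiliesQuadratic → WeilVariationalHodgeQuadratic → WeilClassesImaginaryQuadratic`
(tree glue `weilClassesImaginaryQuadratic_of_anchored_of_variational`). Gen 1's `HC_WeilClassesQuadratic_of_HC_CM`
with the binder `hCM` DISCHARGED. CONDITIONAL on both named hypotheses (OPEN); ON-PATH lemma of the target: tree
`WeilTypeLadder.weilClassesImaginaryQuadratic_of_hodgeConjecture`.
[cite: Markman2025SecantWeil, Thm. 1.5.1 (strategy; preprint, unrefereed)] [cite: vanGeemen1994HodgeAV, Thm. 4.3] -/
theorem HC_WeilClassesQuadratic_of_cmPowerPointed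
    (hP : CMPowerPointedWeilFamiliesQuadratic) (hV : WeilVariationalHodgeQuadratic) :
    WeilClassesImaginaryQuadratic :=
  weilClassesImaginaryQuadratic_of_anchored_of_variational (anchoredWeilFamiliesQuadratic_of_cmPowerPointed hP) hV

/-- **T2 — R∞ WITHOUT `HC_CM` from the LOCAL germ at CM fibres** (`Ring2Transport.LocalWeilVHCAtCMQuadratic`, the
weakest transport hypothesis of the tree: at a CM-charted ALGEBRAIC fibre the class stays algebraic on a Euclidean
neighbourhood). At the CM-power fibre `s₀` the class IS algebraic (`cmPowerAnchor_valid`) and the fibre IS CM-charted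
(`cmAnchor_of_cmPowerAnchor`), so the germ hypothesis applies with no further input; then Baire + Charles–Schnell
(tree `mem_algebraicClasses_of_isOpen_subset_algebraicityLocus`) and read back along `ι`. Gen 1's
`HC_WeilClassesQuadratic_of_HC_CM_local` with `hCM` DISCHARGED. CONDITIONAL on both named hypotheses (OPEN).
[cite: CharlesSchnell2014Notes, Prop. 11.3.11 (proof)] [cite: BuchweitzFlenner2003, Thm. 5.1]
[cite: vanGeemen1994HodgeAV, Thm. 4.3] -/
theorem HC_WeilClassesQuadratic_of_cmPowerPointed_local
    (hP : CMPowerPointedWeilFamiliesQuadratic) (hL : LocalWeilVHCAtCMQuadratic) :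
    WeilClassesImaginaryQuadratic := by
  intro n hn d hd A φ hAdim hX hφ c hcQ hcH hc
  by_cases hc0 : c = 0
  · rw [hc0]; exact Submodule.zero_mem _
  obtain ⟨𝒳, S, f, s₁, s₀, ι, W, hf, h𝒳, hS, hirrS, hsm, hW, hWeil, hread, hanc⟩ :=
    hP n hn d hd A φ hAdim hX hφ c hcQ hcH hc hc0
  haveI := hirrS
  have hs₀ : complexBetti.map (fiberι f s₀) (2 * n) W ∈ algebraicClasses (fiberOver f s₀) n :=
    cmPowerAnchor_valid n _ _ hanc (hW s₀).1 (hW s₀).2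
  obtain ⟨U, hU, hs₀U, hUalg⟩ :=
    hL n hn d hd f hf h𝒳 hS hirrS hsm W hW hWeil s₀ (cmAnchor_of_cmPowerAnchor hanc) hs₀
  have h1 : complexBetti.map (fiberι f s₁) (2 * n) W ∈ algebraicClasses (fiberOver f s₁) n :=
    mem_algebraicClasses_of_isOpen_subset_algebraicityLocus f h𝒳 hS hsm hf W hU ⟨s₀, hs₀U⟩ hUalg s₁
  rw [← hread]
  exact (mem_algebraicClasses_map_iff_of_iso ι).2 h1

/-- **T3 — granted CM-power-pointed families, R∞ is EQUIVALENT to the CM-germ leaf, with NO `HC_CM`** (compare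
`Ring2Transport.weilClassesImaginaryQuadratic_iff_localWeilVHCAtCM_of_HC_CM`, which carries `hCM`). `→`: R∞ ⟹ R∞var ⟹
the germ leaf (tree `weilVariationalHodgeQuadratic_of_weilClassesImaginaryQuadratic`,
`localWeilVHCAtCMQuadratic_of_weilVariationalHodgeQuadratic`); `←`: T2.
[cite: BuchweitzFlenner2003, Thm. 5.1] [cite: CharlesSchnell2014Notes, Prop. 11.3.11] -/
theorem weilClassesImaginaryQuadratic_iff_localWeilVHCAtCM_of_cmPowerPointed
    (hP : CMPowerPointedWeilFamiliesQuadratic) :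
    WeilClassesImaginaryQuadratic ↔ LocalWeilVHCAtCMQuadratic :=
  ⟨fun h ↦ localWeilVHCAtCMQuadratic_of_weilVariationalHodgeQuadratic
      (weilVariationalHodgeQuadratic_of_weilClassesImaginaryQuadratic h),
    fun hL ↦ HC_WeilClassesQuadratic_of_cmPowerPointed_local hP hL⟩

/-! ## §4 Corollaries into ledger items, `HC_CM`-free -/

/-- T4: stmt-HodgeConjecture-2522 (`TropicalCuspLift.WeilClassesAlgebraic`) from CM-power-pointed families + the
CM-germ leaf — NO `HC_CM` (compare `Ring2Transport.HC_WeilClassesAlgebraic_of_HC_CM`; ON-PATH: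
`Ring2Transport.HC_WeilClassesAlgebraic_of_HodgeConjecture`). [cite: Weil1977HodgeRing, pp. 421–429]
[cite: vanGeemen1994HodgeAV, Thm. 4.3] -/
theorem HC_WeilClassesAlgebraic_of_cmPowerPointed
    (hP : CMPowerPointedWeilFamiliesQuadratic) (hL : LocalWeilVHCAtCMQuadratic) :
    Theses.TropicalCuspLift.WeilClassesAlgebraic :=
  weilClassesAlgebraic_of_weilClassesImaginaryQuadratic (HC_WeilClassesQuadratic_of_cmPowerPointed_local hP hL)

/-- T4: stmt-HodgeConjecture-2524 (`SevenfoldWeilCensus.WeilSixfolds`, every `d`, every discriminant; the non-split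
sixfolds are OPEN in refereed print) from CM-power-pointed families + the CM-germ leaf — NO `HC_CM`; ON-PATH lemma =
tree `WeilTypeLadder.weilSixfolds_of_hodgeConjecture`.
[cite: Markman2025SurveySecant, Thm. 1.2 and §11.5 (preprint / ICM 2026 lecture, unrefereed)] [cite: vanGeemen1994HodgeAV, Thm. 4.3] -/
theorem HC_WeilSixfolds_of_cmPowerPointed
    (hP : CMPowerPointedWeilFamiliesQuadratic) (hL : LocalWeilVHCAtCMQuadratic) :
    Theses.SevenfoldWeilCensus.WeilSixfolds :=
  weilSixfolds_of_weilClassesImaginaryQuadratic (HC_WeilClassesQuadratic_of_cmPowerPointed_local hP hL)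

/-- T4: rung R2 (`WeilTypeLadder.SplitWeilAbelianVarieties`, split Weil type, `n ≥ 4` OPEN in print) — NO `HC_CM`;
ON-PATH lemma = tree `WeilTypeLadder.splitWeilAbelianVarieties_of_hodgeConjecture`.
[cite: Markman2025SurveySecant, §12 (preprint / ICM 2026 lecture, unrefereed)] [cite: vanGeemen1994HodgeAV, Thm. 4.3] -/
theorem HC_SplitWeil_of_cmPowerPointed
    (hP : CMPowerPointedWeilFamiliesQuadratic) (hL : LocalWeilVHCAtCMQuadratic) :
    SplitWeilAbelianVarieties :=
  splitWeilAbelianVarieties_of_weilClassesImaginaryQuadratic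
    (HC_WeilClassesQuadratic_of_cmPowerPointed_local hP hL)

/-! ## §5 From the δ-indexed CM-power rows of part VIII to R∞ -/

/-- **T5 — R∞ WITHOUT `HC_CM` from the δ-indexed CM-power rows**: if EVERY component `(ℚ(√-d), 2n, δ)` (`n ≥ 2`,
`d > 0`) carries CM-power-pointed families (part VIII's leaf) and satisfies the δ-restricted Weil-confined VHC, then —
granted van Geemen's Lemma 5.2 (typed, `PolarizedWeilDiscriminantExists`: every polarized Weil triple HAS a
discriminant class) — Weil's question R∞ holds: part VIII's W1‴ on each component, assembled by part VII-B's W3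
(`weilClassesImaginaryQuadratic_of_byComponent`). [cite: vanGeemen1994HodgeAV, Lemma 5.2 and Thm. 4.3]
[cite: Markman2025SecantWeil, Thm. 1.5.1 (strategy; preprint, unrefereed)] -/
theorem weilClassesImaginaryQuadratic_of_forall_cmPowerPointedComponent (hE : PolarizedWeilDiscriminantExists)
    (hP : ∀ (n : ℕ), 2 ≤ n → ∀ (d : ℕ), 0 < d → ∀ δ : weilNormResidueGroup d,
      CMPowerPointedWeilFamiliesComponent n d δ)
    (hV : ∀ (n : ℕ), 2 ≤ n → ∀ (d : ℕ), 0 < d → ∀ δ : weilNormResidueGroup d,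
      WeilVariationalHodgeComponent n d δ) :
    WeilClassesImaginaryQuadratic :=
  weilClassesImaginaryQuadratic_of_byComponent hE
    fun n hn d hd δ => weilClassesComponent_of_cmPowerPointed (hP n hn d hd δ) (hV n hn d hd δ)

end Summit.HodgeConjecture.HodgeConjecture.Ring2.Hypotheses
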